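import Mathlib.LinearAlgebra.Matrix.Transvection
import Literature.Computability.AlgebraicComplexity.MS2001FormESymmetries
import HarnessLib

/-!
# GCT I §7–8: the stabilizer of `E(X)` acts irreducibly on the variables (infinite fields)

Companion of `MS2001ClassVarieties.lean` (named fact `MS2001_thm_7_3`: the form
`E(X) = ∏_σ det_σ(X)` of GCT I §7 is `SL`-stable over every algebraically closed field; K. D.
Mulmuley, M. Sohoni, SIAM J. Comput. 31 (2001), authors' version (AV) Thm. 7.3, p.31) and of
`MS2001FormESymmetries.lean` (explicit elements of the stabilizer of `E(X)`: `SL_m` on the rows,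
the column torus, the relabellings). Theorem-only.

MAIN RESULT (`MS2001_msEStabilizer_irreducible`, typed exactly like the tree's
`MS2001_detStabilizer_irreducible` / `MS2001_perStabilizer_irreducible` for `det_m` / `per_n`):
over an INFINITE field `K`, for `m ≥ 2` (any `k`) or `k ≥ 3` (any `m`), a subspace of the
coordinate space `K^{m·(m·k)}` of the variables `X = (X^j_i)_r` that is invariant under every
`γ ∈ SL_{km²}(K)` fixing `E(X)` is `0` or everything. This is the hypothesis of Kempf's
stability criterion in the form the tree has it (`MS2001KempfStabilityHolds.lean`,
`exists_submodule_stable_of_not_isPolystable`: a non-closed `SL`-orbit of a form yields a proper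
nonzero subspace stable under the stabilizer), whence GCT I Thm. 7.3 for these `(m,k)` over every
algebraically closed field — the printed proof (GCT I §8) runs Kempf's machinery on the finite
wreath-product part `D'` of the stabilizer only and has to locate its parabolic; using the torus
and `SL_m` as well, no proper parabolic survives. The excluded corner `(m,k) = (1,2)`
(`E = x·y`, stabilizer = a torus, coordinate lines invariant) is genuinely reducible; `(1,1)`,
`(1,0)`, `m = 0` are degenerate.

PROOF (as for `per_n` in `MS2001ClassVarieties.lean`). Let `0 ≠ w ∈ W`, `w x₀ ≠ 0`,
`x₀ = (r₀,(i₀,j₀))`. Torus filters: the row torus `diag(θ^{[r=r₀]} θ^{-[r=r₁]}) ⊗ 1` and the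
column torus `1 ⊗ diag(θ^{[c=c₀]} θ^{-[c=c₁]})` have determinant one and fix `E(X)`
(`linSubst_diagonal_fst_msE`, `linSubst_diagonal_snd_msE`); with `θ ≠ 0, ±1` the operators
`(g − θ⁻¹)(g − 1)` cut `w` down to its row `r₀`, then to the single entry `x₀`
(`single_mem_of_apply_ne_zero`). Moves: the row transvections `(1 + E_{r r₀}) ⊗ 1 ∈ SL_m ⊗ 1`
(`single_row_move`), the relabelling swapping block `i₀` with block `i` AND row `i₀` with row `i`
(signs cancel: `single_block_move`), and inside a block either the same transposition in two
blocks (`m ≥ 2`) or a `3`-cycle (`k ≥ 3`) (`single_col_move`) carry `e_{x₀}` to every `e_x`.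
HONEST FRAMING: classical bookkeeping towards a GIT stability statement; nothing here bears on the
conjectures of GCT I §7, on P versus NP, or on VP versus VNP.

## References

* [MulmuleySohoniSIAM2001] K. D. Mulmuley, M. Sohoni, *Geometric complexity theory I*, SIAM J.
  Comput. 31 (2001) 496–526: Prop. 7.1 (the stabilizer of `E(X)`, AV p.31), Thm. 7.3 and its
  proof, §8 (AV pp.34–37).
* [Kempf1978] G. R. Kempf, *Instability in invariant theory*, Ann. of Math. 108 (1978), Cor. 4.4–4.5.
-/

noncomputable section

namespace Literature.Computability.AlgebraicComplexity

namespace MS2001FormE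

open MvPolynomial MS2001Thm73
open scoped Kronecker

variable {K : Type*} [Field K] {m kk : ℕ}

/-! ## Scalars avoiding `0, ±1` -/

/-- An infinite field has an element `θ ≠ 0, 1, -1`. [cite: MulmuleySohoniSIAM2001, Prop. 7.1 (the torus T, AV p.31)] -/
theorem exists_ne_zero_ne_one_ne_neg_one [Infinite K] : ∃ θ : K, θ ≠ 0 ∧ θ ≠ 1 ∧ θ ≠ -1 := by
  classical
  obtain ⟨θ, hθ⟩ := Infinite.exists_notMem_finset ({0, 1, -1} : Finset K)
  simp only [Finset.mem_insert, Finset.mem_singleton, not_or] at hθ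
  exact ⟨θ, hθ.1, hθ.2.1, hθ.2.2⟩

/-- For `θ ≠ 0, 1, -1` the filter constant `(θ − θ⁻¹)(θ − 1)` is nonzero.
[cite: MulmuleySohoniSIAM2001, Prop. 7.1 (the torus T, AV p.31)] -/
theorem filter_const_ne_zero {θ : K} (h0 : θ ≠ 0) (h1 : θ ≠ 1) (hm1 : θ ≠ -1) :
    (θ - θ⁻¹) * (θ - 1) ≠ 0 := by
  refine mul_ne_zero (sub_ne_zero.mpr fun h => ?_) (sub_ne_zero.mpr h1)
  have hsq : θ * θ = 1 :=
    calc θ * θ = θ * θ⁻¹ := congrArg (θ * ·) h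
      _ = 1 := mul_inv_cancel₀ h0
  rcases mul_self_eq_one_iff.mp hsq with h' | h'
  · exact h1 h'
  · exact hm1 h'

/-! ## Torus filters -/

section Stable

variable {W : Submodule K (Fin m × (Fin m × Fin kk) → K)}

/-- One filter step: if the diagonal matrix `diag β` has determinant one and fixes `E(X)`, then
with `w ∈ W` also `x ↦ (β x − c) · w x` lies in the stable subspace `W`.
[cite: MulmuleySohoniSIAM2001, Prop. 7.1 (the torus T, AV p.31)] -/
theorem diag_filter_mem
    (hW : ∀ A : Matrix (Fin m × (Fin m × Fin kk)) (Fin m × (Fin m × Fin kk)) K, A.det = 1 →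
      linSubst (Fin m × (Fin m × Fin kk)) K A (msE K m kk) = msE K m kk →
      ∀ w ∈ W, A.mulVec w ∈ W)
    {β : Fin m × (Fin m × Fin kk) → K} (hdet : (Matrix.diagonal β).det = 1)
    (hE : linSubst (Fin m × (Fin m × Fin kk)) K (Matrix.diagonal β) (msE K m kk) = msE K m kk)
    (c : K) {w : Fin m × (Fin m × Fin kk) → K} (hw : w ∈ W) :
    (fun x => (β x - c) * w x) ∈ W := by
  have h1 := hW _ hdet hE w hw
  have h1' : (Matrix.diagonal β).mulVec w = fun x => β x * w x :=
    funext fun x => Matrix.mulVec_diagonal β w x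
  rw [h1'] at h1
  convert W.sub_mem h1 (W.smul_mem c hw) using 1
  funext x
  simp only [Pi.sub_apply, Pi.smul_apply, smul_eq_mul]
  ring

/-- **Row filter**: with `w ∈ W` also the restriction of `w` to the row `r₀` lies in `W`
(row torus `diag(θ^{[r=r₀]} θ^{-[r=r₁]}) ⊗ 1`, determinant one, fixing `E(X)`; infinite `K`).
[cite: MulmuleySohoniSIAM2001, Prop. 7.1 (AV p.31)] -/
theorem row_restrict_mem [Infinite K]
    (hW : ∀ A : Matrix (Fin m × (Fin m × Fin kk)) (Fin m × (Fin m × Fin kk)) K, A.det = 1 →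
      linSubst (Fin m × (Fin m × Fin kk)) K A (msE K m kk) = msE K m kk →
      ∀ w ∈ W, A.mulVec w ∈ W)
    {w : Fin m × (Fin m × Fin kk) → K} (hw : w ∈ W) (r₀ : Fin m) :
    (fun x : Fin m × (Fin m × Fin kk) => if x.1 = r₀ then w x else 0) ∈ W := by
  by_cases hr : ∃ r₁ : Fin m, r₁ ≠ r₀
  · obtain ⟨r₁, hr₁⟩ := hr
    obtain ⟨θ, hθ0, hθ1, hθm1⟩ := exists_ne_zero_ne_one_ne_neg_one (K := K)
    set s : Fin m → K := fun r => (if r = r₀ then θ else 1) * (if r = r₁ then θ⁻¹ else 1) with hs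
    have hprod : ∏ r, s r = 1 := by
      simp only [hs]
      rw [Finset.prod_mul_distrib, Finset.prod_ite_eq', Finset.prod_ite_eq']
      simp only [Finset.mem_univ, if_true, mul_inv_cancel₀ hθ0]
    have hdet : (Matrix.diagonal fun v : Fin m × (Fin m × Fin kk) => s v.1).det = 1 := by
      rw [det_diagonal_fst, hprod, one_pow]
    have hE : linSubst (Fin m × (Fin m × Fin kk)) K
        (Matrix.diagonal fun v : Fin m × (Fin m × Fin kk) => s v.1) (msE K m kk) = msE K m kk := by
      rw [linSubst_diagonal_fst_msE, hprod, one_pow, C_1, one_mul]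
    have h2 := diag_filter_mem hW hdet hE θ⁻¹ (diag_filter_mem hW hdet hE 1 hw)
    have hfun : (fun x : Fin m × (Fin m × Fin kk) => (s x.1 - θ⁻¹) * ((s x.1 - 1) * w x)) =
        ((θ - θ⁻¹) * (θ - 1)) • fun x => if x.1 = r₀ then w x else 0 := by
      funext x
      simp only [Pi.smul_apply, smul_eq_mul, hs]
      by_cases h0 : x.1 = r₀
      · have h1' : x.1 ≠ r₁ := fun h => hr₁ (h.symm.trans h0)
        rw [if_pos h0, if_neg h1', if_pos h0, mul_one]
        ring
      · rw [if_neg h0, if_neg h0, one_mul, mul_zero]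
        by_cases h1' : x.1 = r₁
        · rw [if_pos h1', sub_self, zero_mul]
        · rw [if_neg h1', sub_self, zero_mul, mul_zero]
    rw [hfun] at h2
    have h3 := W.smul_mem ((θ - θ⁻¹) * (θ - 1))⁻¹ h2
    rwa [smul_smul, inv_mul_cancel₀ (filter_const_ne_zero hθ0 hθ1 hθm1), one_smul] at h3
  · push Not at hr
    have : (fun x : Fin m × (Fin m × Fin kk) => if x.1 = r₀ then w x else 0) = w :=
      funext fun x => by rw [if_pos (hr x.1)]
    rw [this]
    exact hw

/-- **Column filter**: with `w ∈ W` also the restriction of `w` to the column `c₀` lies in `W`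
(column torus `1 ⊗ diag(θ^{[c=c₀]} θ^{-[c=c₁]})`, determinant one, fixing `E(X)` since every
column enters the same number `k^{m-1}` of factors; infinite `K`).
[cite: MulmuleySohoniSIAM2001, Prop. 7.1 (the torus T, AV p.31)] -/
theorem col_restrict_mem [Infinite K]
    (hW : ∀ A : Matrix (Fin m × (Fin m × Fin kk)) (Fin m × (Fin m × Fin kk)) K, A.det = 1 →
      linSubst (Fin m × (Fin m × Fin kk)) K A (msE K m kk) = msE K m kk →
      ∀ w ∈ W, A.mulVec w ∈ W)
    {w : Fin m × (Fin m × Fin kk) → K} (hw : w ∈ W) (c₀ : Fin m × Fin kk) :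
    (fun x : Fin m × (Fin m × Fin kk) => if x.2 = c₀ then w x else 0) ∈ W := by
  by_cases hc : ∃ c₁ : Fin m × Fin kk, c₁ ≠ c₀
  · obtain ⟨c₁, hc₁⟩ := hc
    obtain ⟨θ, hθ0, hθ1, hθm1⟩ := exists_ne_zero_ne_one_ne_neg_one (K := K)
    set t : Fin m × Fin kk → K := fun c => (if c = c₀ then θ else 1) * (if c = c₁ then θ⁻¹ else 1)
      with ht
    have hprod : ∏ c, t c = 1 := by
      simp only [ht]
      rw [Finset.prod_mul_distrib, Finset.prod_ite_eq', Finset.prod_ite_eq']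
      simp only [Finset.mem_univ, if_true, mul_inv_cancel₀ hθ0]
    have hdet : (Matrix.diagonal fun v : Fin m × (Fin m × Fin kk) => t v.2).det = 1 := by
      rw [det_diagonal_snd, hprod, one_pow]
    have hE : linSubst (Fin m × (Fin m × Fin kk)) K
        (Matrix.diagonal fun v : Fin m × (Fin m × Fin kk) => t v.2) (msE K m kk) = msE K m kk := by
      rw [linSubst_diagonal_snd_msE, hprod, one_pow, C_1, one_mul]
    have h2 := diag_filter_mem hW hdet hE θ⁻¹ (diag_filter_mem hW hdet hE 1 hw)
    have hfun : (fun x : Fin m × (Fin m × Fin kk) => (t x.2 - θ⁻¹) * ((t x.2 - 1) * w x)) =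
        ((θ - θ⁻¹) * (θ - 1)) • fun x => if x.2 = c₀ then w x else 0 := by
      funext x
      simp only [Pi.smul_apply, smul_eq_mul, ht]
      by_cases h0 : x.2 = c₀
      · have h1' : x.2 ≠ c₁ := fun h => hc₁ (h.symm.trans h0)
        rw [if_pos h0, if_neg h1', if_pos h0, mul_one]
        ring
      · rw [if_neg h0, if_neg h0, one_mul, mul_zero]
        by_cases h1' : x.2 = c₁
        · rw [if_pos h1', sub_self, zero_mul]
        · rw [if_neg h1', sub_self, zero_mul, mul_zero]
    rw [hfun] at h2
    have h3 := W.smul_mem ((θ - θ⁻¹) * (θ - 1))⁻¹ h2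
    rwa [smul_smul, inv_mul_cancel₀ (filter_const_ne_zero hθ0 hθ1 hθm1), one_smul] at h3
  · push Not at hc
    have : (fun x : Fin m × (Fin m × Fin kk) => if x.2 = c₀ then w x else 0) = w :=
      funext fun x => by rw [if_pos (hc x.2)]
    rw [this]
    exact hw

/-- **Two filters isolate an entry**: `w ∈ W`, `w x₀ ≠ 0` ⇒ `e_{x₀} ∈ W` (infinite `K`; any
`m`, `k`). [cite: MulmuleySohoniSIAM2001, Prop. 7.1 (AV p.31)] -/
theorem single_mem_of_apply_ne_zero [Infinite K]
    (hW : ∀ A : Matrix (Fin m × (Fin m × Fin kk)) (Fin m × (Fin m × Fin kk)) K, A.det = 1 →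
      linSubst (Fin m × (Fin m × Fin kk)) K A (msE K m kk) = msE K m kk →
      ∀ w ∈ W, A.mulVec w ∈ W)
    {w : Fin m × (Fin m × Fin kk) → K} (hw : w ∈ W) {x₀ : Fin m × (Fin m × Fin kk)}
    (hx₀ : w x₀ ≠ 0) : (Pi.single x₀ 1 : Fin m × (Fin m × Fin kk) → K) ∈ W := by
  have h2 := col_restrict_mem hW (row_restrict_mem hW hw x₀.1) x₀.2
  have hfun : (fun x : Fin m × (Fin m × Fin kk) =>
      if x.2 = x₀.2 then (if x.1 = x₀.1 then w x else 0) else 0) =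
      w x₀ • (Pi.single x₀ 1 : Fin m × (Fin m × Fin kk) → K) := by
    funext x
    rw [Pi.smul_apply, Pi.single_apply, smul_eq_mul, mul_ite, mul_one, mul_zero]
    by_cases hx : x = x₀
    · subst hx
      rw [if_pos rfl, if_pos rfl, if_pos rfl]
    · rw [if_neg hx]
      by_cases h2' : x.2 = x₀.2
      · rw [if_pos h2', if_neg fun h1' => hx (Prod.ext h1' h2')]
      · rw [if_neg h2']
  rw [hfun] at h2
  have h3 := W.smul_mem (w x₀)⁻¹ h2
  rwa [smul_smul, inv_mul_cancel₀ hx₀, one_smul] at h3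

/-! ## Moves -/

/-- **Row move** by the transvection `(1 + E_{r r₀}) ⊗ 1 ∈ SL_m ⊗ 1` (fixing `E(X)`):
`e_{(r₀,c)} ∈ W ⇒ e_{(r,c)} ∈ W`. [cite: MulmuleySohoniSIAM2001, Prop. 7.1 eq. (12) (AV p.31)] -/
theorem single_row_move
    (hW : ∀ A : Matrix (Fin m × (Fin m × Fin kk)) (Fin m × (Fin m × Fin kk)) K, A.det = 1 →
      linSubst (Fin m × (Fin m × Fin kk)) K A (msE K m kk) = msE K m kk →
      ∀ w ∈ W, A.mulVec w ∈ W)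
    {r₀ : Fin m} {c : Fin m × Fin kk}
    (h : (Pi.single (r₀, c) 1 : Fin m × (Fin m × Fin kk) → K) ∈ W) (r : Fin m) :
    (Pi.single (r, c) 1 : Fin m × (Fin m × Fin kk) → K) ∈ W := by
  by_cases hr : r = r₀
  · rw [hr]; exact h
  have hg : (Matrix.transvection r r₀ (1 : K)).det = 1 := Matrix.det_transvection_of_ne r r₀ hr 1
  have h1 := hW _ (by rw [det_kronecker_one, hg, one_pow]) (linSubst_kronecker_one_msE_of_det hg)
    _ h
  have hvec : (Matrix.transvection r r₀ (1 : K) ⊗ₖ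
      (1 : Matrix (Fin m × Fin kk) (Fin m × Fin kk) K)).mulVec (Pi.single (r₀, c) 1) =
      (Pi.single (r₀, c) 1 : Fin m × (Fin m × Fin kk) → K) + Pi.single (r, c) 1 := by
    rw [kronecker_one_mulVec_single]
    funext v
    obtain ⟨r', c'⟩ := v
    simp only [Matrix.transvection, Matrix.add_apply, Matrix.one_apply, Matrix.single,
      Matrix.of_apply, Pi.add_apply, Pi.single_apply, Prod.mk.injEq, mul_one, and_true]
    by_cases hc : c' = c
    · subst hc
      by_cases h1' : r' = r₀
      · subst h1'
        simp [hr, Ne.symm hr]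
      · by_cases h2' : r' = r
        · subst h2'
          simp [h1']
        · simp [h1', h2', Ne.symm h2']
    · simp [hc]
  rw [hvec] at h1
  have h2 := W.sub_mem h1 h
  rwa [add_sub_cancel_left] at h2

/-- **Block move** by the relabelling swapping block `i₀` with block `i` and row `i₀` with row
`i` (the two signs cancel on `E(X)` and in the determinant): `e_{(r₀,(i₀,j))} ∈ W ⇒
e_{(ρ r₀,(i,j))} ∈ W` with `ρ = (i₀ i)`. [cite: MulmuleySohoniSIAM2001, Prop. 7.1 (the wreath product, AV p.31)] -/
theorem single_block_move
    (hW : ∀ A : Matrix (Fin m × (Fin m × Fin kk)) (Fin m × (Fin m × Fin kk)) K, A.det = 1 →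
      linSubst (Fin m × (Fin m × Fin kk)) K A (msE K m kk) = msE K m kk →
      ∀ w ∈ W, A.mulVec w ∈ W)
    {r₀ i₀ : Fin m} {j : Fin kk}
    (h : (Pi.single (r₀, (i₀, j)) 1 : Fin m × (Fin m × Fin kk) → K) ∈ W) (i : Fin m) :
    (Pi.single (Equiv.swap i₀ i r₀, (i, j)) 1 : Fin m × (Fin m × Fin kk) → K) ∈ W := by
  have h1 := hW (Equiv.Perm.permMatrix K (relabel (Equiv.swap i₀ i) (Equiv.swap i₀ i)
      (fun _ => (1 : Equiv.Perm (Fin kk)))).symm)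
    (det_relabel_permMatrix_eq_one rfl (by simp))
    (linSubst_relabel_permMatrix_msE_of_sign_eq _ rfl) _ h
  rwa [permMatrix_symm_mulVec_single, relabel_apply_eq, Equiv.swap_apply_left,
    Equiv.Perm.one_apply] at h1

/-- **In-block column move**: `e_{(r,(i₀,j₀))} ∈ W ⇒ e_{(r,(i₀,j))} ∈ W`, by the relabelling
transposing `j₀, j` in block `i₀` AND in a second block (`m ≥ 2`; determinant `(−1)² = 1`,
`E(X)` fixed), or by a `3`-cycle of the columns of every block (`k ≥ 3`).
[cite: MulmuleySohoniSIAM2001, Prop. 7.1 (the wreath product, AV p.31)] -/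
theorem single_col_move (hmk : 2 ≤ m ∨ 3 ≤ kk)
    (hW : ∀ A : Matrix (Fin m × (Fin m × Fin kk)) (Fin m × (Fin m × Fin kk)) K, A.det = 1 →
      linSubst (Fin m × (Fin m × Fin kk)) K A (msE K m kk) = msE K m kk →
      ∀ w ∈ W, A.mulVec w ∈ W)
    {r i₀ : Fin m} {j₀ : Fin kk}
    (h : (Pi.single (r, (i₀, j₀)) 1 : Fin m × (Fin m × Fin kk) → K) ∈ W) (j : Fin kk) :
    (Pi.single (r, (i₀, j)) 1 : Fin m × (Fin m × Fin kk) → K) ∈ W := by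
  by_cases hj : j = j₀
  · rw [hj]; exact h
  -- a family `π` of in-block permutations with `π i₀ j₀ = j` and `∏ sign (π i) = 1`
  obtain ⟨π, hπ, hsign⟩ : ∃ π : Fin m → Equiv.Perm (Fin kk), π i₀ j₀ = j ∧
      ∏ i, Equiv.Perm.sign (π i) = 1 := by
    rcases hmk with hm | hk
    · -- the same transposition in block `i₀` and in a second block `i₁`
      obtain ⟨i₁, hi₁⟩ : ∃ i₁ : Fin m, i₁ ≠ i₀ := by
        have : Nontrivial (Fin m) := Fin.nontrivial_iff_two_le.mpr hm
        exact exists_ne i₀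
      refine ⟨fun i => if i = i₀ then Equiv.swap j₀ j else if i = i₁ then Equiv.swap j₀ j else 1,
        by simp [Equiv.swap_apply_left], ?_⟩
      rw [← Finset.mul_prod_erase Finset.univ _ (Finset.mem_univ i₀),
        ← Finset.mul_prod_erase (Finset.univ.erase i₀) _
          (Finset.mem_erase.mpr ⟨hi₁, Finset.mem_univ i₁⟩),
        Finset.prod_eq_one fun i hi => ?_]
      · simp only [↓reduceIte, if_neg hi₁, mul_one, Int.units_mul_self]
      · obtain ⟨hi1, hi0⟩ : i ≠ i₁ ∧ i ≠ i₀ := by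
          simpa only [Finset.mem_erase, Finset.mem_univ, and_true] using hi
        simp only [if_neg hi0, if_neg hi1, Equiv.Perm.sign_one]
    · -- a `3`-cycle `(j₀ j' )(j₀ j)` in every block
      obtain ⟨j', hj'⟩ : ∃ j' : Fin kk, j' ∉ ({j₀, j} : Finset (Fin kk)) := by
        have hlt : ({j₀, j} : Finset (Fin kk)).card < (Finset.univ : Finset (Fin kk)).card := by
          rw [Finset.card_univ, Fintype.card_fin]
          exact lt_of_le_of_lt Finset.card_le_two (by omega)
        obtain ⟨j', -, hj'⟩ := Finset.exists_mem_notMem_of_card_lt_card hlt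
        exact ⟨j', hj'⟩
      simp only [Finset.mem_insert, Finset.mem_singleton, not_or] at hj'
      have hτ : Equiv.Perm.sign (Equiv.swap j₀ j' * Equiv.swap j₀ j) = 1 := by
        rw [Equiv.Perm.sign_mul, Equiv.Perm.sign_swap (Ne.symm hj'.1),
          Equiv.Perm.sign_swap (Ne.symm hj), Int.units_mul_self]
      refine ⟨fun _ => Equiv.swap j₀ j' * Equiv.swap j₀ j, ?_,
        Finset.prod_eq_one fun _ _ => hτ⟩
      rw [Equiv.Perm.mul_apply, Equiv.swap_apply_left,
        Equiv.swap_apply_of_ne_of_ne hj (Ne.symm hj'.2)]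
  have h1 := hW (Equiv.Perm.permMatrix K (relabel 1 1 π).symm)
    (det_relabel_permMatrix_eq_one rfl hsign) (linSubst_relabel_permMatrix_msE_of_sign_eq _ rfl) _ h
  rwa [permMatrix_symm_mulVec_single, relabel_apply_eq, Equiv.Perm.one_apply, Equiv.Perm.one_apply,
    hπ] at h1

/-- A subspace of `K^ι` containing every elementary vector is everything. [cite: MulmuleySohoniSIAM2001, proof of Thm. 4.7 (AV p.15)] -/
theorem eq_top_of_forall_pi_single_mem {ι : Type*} [Fintype ι] [DecidableEq ι]
    {W : Submodule K (ι → K)} (h : ∀ x : ι, (Pi.single x 1 : ι → K) ∈ W) : W = ⊤ := by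
  refine Submodule.eq_top_iff'.mpr fun v => ?_
  rw [← Finset.univ_sum_single v]
  refine W.sum_mem fun x _ => ?_
  have hx : (Pi.single x (v x) : ι → K) = v x • (Pi.single x 1 : ι → K) := by
    funext y
    rw [Pi.smul_apply, Pi.single_apply, Pi.single_apply, smul_eq_mul, mul_ite, mul_one, mul_zero]
  rw [hx]
  exact W.smul_mem _ (h x)

/-- **Irreducibility, matrix form**: over an infinite field, for `m ≥ 2` or `k ≥ 3`, a subspace
of the variable space stable under every determinant-one matrix whose substitution fixes `E(X)`
is `0` or everything. [cite: MulmuleySohoniSIAM2001, Prop. 7.1 and proof of Thm. 7.3 (AV pp.31, 34–37)] -/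
theorem msE_stabilizer_irreducible_matrix [Infinite K] (hmk : 2 ≤ m ∨ 3 ≤ kk)
    (W : Submodule K (Fin m × (Fin m × Fin kk) → K))
    (hW : ∀ A : Matrix (Fin m × (Fin m × Fin kk)) (Fin m × (Fin m × Fin kk)) K, A.det = 1 →
      linSubst (Fin m × (Fin m × Fin kk)) K A (msE K m kk) = msE K m kk →
      ∀ w ∈ W, A.mulVec w ∈ W) :
    W = ⊥ ∨ W = ⊤ := by
  rcases eq_or_ne W ⊥ with h0 | h0
  · exact Or.inl h0
  right
  obtain ⟨w, hw, hw0⟩ := (Submodule.ne_bot_iff W).mp h0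
  obtain ⟨x₀, hx₀⟩ := Function.ne_iff.mp hw0
  have hone := single_mem_of_apply_ne_zero hW hw hx₀
  refine eq_top_of_forall_pi_single_mem fun x => ?_
  obtain ⟨r₀, i₀, j₀⟩ := x₀
  obtain ⟨r, i, j⟩ := x
  exact single_row_move hW (single_block_move hW (single_col_move hmk hW hone j) i) r

/-- **Irreducibility, `SL`-typed form** (the currency of `exists_submodule_stable_of_not_isPolystable`):
stable under every `γ : SL_{km²}(K)` whose substitution fixes `E(X)` ⇒ `0` or everything
(`K` infinite; `m ≥ 2` or `k ≥ 3`). [cite: MulmuleySohoniSIAM2001, Prop. 7.1 and proof of Thm. 7.3 (AV pp.31, 34–37)] -/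
theorem msE_stabilizer_irreducible_sl [Infinite K] (hmk : 2 ≤ m ∨ 3 ≤ kk)
    (W : Submodule K (Fin m × (Fin m × Fin kk) → K))
    (hW : ∀ γ : Matrix.SpecialLinearGroup (Fin m × (Fin m × Fin kk)) K,
      linSubst (Fin m × (Fin m × Fin kk)) K
        (γ : Matrix (Fin m × (Fin m × Fin kk)) (Fin m × (Fin m × Fin kk)) K) (msE K m kk) =
        msE K m kk →
      ∀ x ∈ W, (γ : Matrix (Fin m × (Fin m × Fin kk)) (Fin m × (Fin m × Fin kk)) K).mulVec x ∈ W) :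
    W = ⊥ ∨ W = ⊤ :=
  msE_stabilizer_irreducible_matrix hmk W fun A hA hE w hw => hW ⟨A, hA⟩ hE w hw

end Stable

end MS2001FormE

/-- **The stabilizer of `E(X)` in `SL_{km²}` acts irreducibly on the variables** (GCT I §7–8;
the hypothesis of Kempf's stability criterion for Thm. 7.3, typed exactly like
`MS2001_detStabilizer_irreducible` / `MS2001_perStabilizer_irreducible` for the defining action
`w ↦ γ w` on coordinate vectors `w : Fin m × (Fin m × Fin k) → K`): over an INFINITE field `K`,
for `m ≥ 2` (any `k`) or `k ≥ 3` (any `m`), a subspace invariant under every `γ ∈ SL_{km²}(K)`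
fixing `E(X) = msE K m k` is `0` or everything. (The corner `(m,k) = (1,2)`, `E = xy`, is
genuinely reducible and excluded.) Proof: torus filters cut a nonzero `w ∈ W` down to an
elementary vector (`MS2001FormE.single_mem_of_apply_ne_zero`); row transvections in `SL_m ⊗ 1`,
sign-balanced block/row relabellings and even in-block relabellings move it to every elementary
vector. Mulmuley–Sohoni's printed §8 instead locates the parabolic of the finite group `D'`; with
the torus and `SL_m` included no proper parabolic contains the stabilizer.
[cite: MulmuleySohoniSIAM2001, Prop. 7.1 and Thm. 7.3 with its proof, §8 (AV pp.31, 34–37)] -/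
theorem MS2001_msEStabilizer_irreducible {K : Type*} [Field K] [Infinite K] {m kk : ℕ}
    (hmk : 2 ≤ m ∨ 3 ≤ kk) (W : Submodule K (Fin m × (Fin m × Fin kk) → K))
    (hW : ∀ γ ∈ slSubgroup (Fin m × (Fin m × Fin kk)) K ⊓ linStabilizer (msE K m kk),
      ∀ w ∈ W, (γ : Matrix (Fin m × (Fin m × Fin kk)) (Fin m × (Fin m × Fin kk)) K).mulVec w ∈ W) :
    W = ⊥ ∨ W = ⊤ := by
  refine MS2001FormE.msE_stabilizer_irreducible_matrix hmk W fun A hA hE w hw => ?_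
  have hA0 : A.det ≠ 0 := by rw [hA]; exact one_ne_zero
  have h1 := hW (Matrix.GeneralLinearGroup.mkOfDetNeZero A hA0) (Subgroup.mem_inf.mpr
    ⟨mem_slSubgroup_iff.mpr (by rw [Matrix.GeneralLinearGroup.val_mkOfDetNeZero]; exact hA),
     mem_linStabilizer.mpr (by
      rw [linSubstRep_apply, Matrix.GeneralLinearGroup.val_mkOfDetNeZero]; exact hE)⟩) w hw
  rwa [Matrix.GeneralLinearGroup.val_mkOfDetNeZero] at h1

end Literature.Computability.AlgebraicComplexity

end
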